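import Literature.Claims.NS.Wu2026
import HarnessLib

/-!
# C177 `Wu2026` — the binder `Step_construct` (§3.2–§3.4, Euler blow-down tangent) ASSEMBLED from
# five sub-binders (cell `pub/ns-inputs`, seat `ns-in-wu-con`, D-0154 (2) INPUTS; route business of
# `GaldiLiouvilleGate`, item stmt-NavierStokesRegularity-0897)

The open binder `Literature.Claims.NS.Wu2026.Step_construct` (skeleton l.362) asks to inhabit the
structure `Tangent ν v p` — the Euler blow-down tangent of §3.2–§3.4 of W. Wu, arXiv:2608.22471v1 —
from the good scales of Lemma 3.1, the annular bound (3.18) and the canonical pressure (3.41).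
This file splits that construction EXACTLY along the printed sub-steps and PROVES the assembly
(subsequence bookkeeping only; the exponent of (3.26) is fixed to `q₀ = 4 ∈ (3, 9/2)`):

* (A) velocity compactness (3.26)–(3.28) (p.11 l.13–50): along a subsequence of ANY scales
  `R_j = 2^{n_j} → ∞`, `V_j = R_j^{2/3} v(R_j ·) → V` in `L⁴_loc(ℝ³ ∖ {0})`;
* (B) pressure compactness (3.45) (p.16 l.3–27): along a further subsequence,
  `P_j = R_j^{4/3}(p − c)(R_j ·) → P` in `L²_loc(ℝ³ ∖ {0})`;
* (C) the limit equations (3.50)–(3.51), `div V = 0`, and the Bernoulli law (3.57)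
  (p.17 l.53 – p.19 l.76: `ν_j = ν R_j^{-1/3} → 0`, the local energy identity (3.54)–(3.56));
* (D) the inherited scale-invariant weak bounds (3.61) on annuli (p.21 l.5–24; Lemma 3.2 p.11);
* (E) the Sobolev bounds (3.35) on `{|y| > 1}` at GOOD scales (p.13 l.6–83: (3.32)–(3.35)).

`step_construct_of_pieces : (A) → (B) → (C) → (D) → (E) → Step_construct` — a sub-subsequence of
good scales is good (`j ≤ σ j`), limits pass to subsequences, and the fields of `Tangent` are read
off. The five hypotheses are stated in the skeleton's own vocabulary (`blowDown`, `blowDownP`,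
`bern`, `annulus`, `dyMass`, `punctured`, `exterior`, `IsTest`, `IsTestVec`, `WeakDivFreeOn`), so
that each can be discharged by a separate file.

Theorems only, standard axioms, no `sorry`.

WHAT THIS IS NOT: not a proof of `Step_construct` (the five pieces are hypotheses here); not a
claim about NS regularity or blow-up; item 0897 is a route crux (GaldiLiouvilleGate), not the
summit; not a claim about any author beyond the typed locator.
-/

set_option linter.dupNamespace false

noncomputable section

open MeasureTheory Set Filter Topology
open scoped ENNReal NNReal Topology RealInnerProductSpace

namespace Summit.NavierStokesRegularity.NavierStokesRegularity.Theorems.Wu2026Salvage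

open Literature.Analysis.FluidPDE Literature.Analysis.FunctionSpaces Literature.Claims.NS.Wu2026

/-- A subsequence of good dyadic scales is good: if `a_{n_j+m} ≤ B_m` for `j ≥ max{1,m}` and
`σ` is strictly increasing then the same holds for `n ∘ σ` (since `j ≤ σ j`) — the remark «a
subsequence of good scales is again good» behind p.11 l.44–50, p.16 l.3–6. [cite: Wu2026, (3.9) p.9 l.46–51; p.11 l.44–50] -/
theorem good_comp_strictMono {v : E3 → E3} {n : ℕ → ℕ}
    (hgood : ∀ m : ℕ, ∃ B : ℝ, ∀ j : ℕ, max 1 m ≤ j → dyMass v (n j + m) ≤ B)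
    {σ : ℕ → ℕ} (hσ : StrictMono σ) :
    ∀ m : ℕ, ∃ B : ℝ, ∀ j : ℕ, max 1 m ≤ j → dyMass v (n (σ j) + m) ≤ B := by
  intro m
  obtain ⟨B, hB⟩ := hgood m
  exact ⟨B, fun j hj => hB (σ j) (hj.trans (hσ.id_le j))⟩

/-- **`Step_construct` from the five printed sub-steps of §3.2–§3.4** (velocity compactness
(3.28), pressure compactness (3.45), limit equations (3.51)/(3.57), inherited weak bounds (3.61),
Sobolev bounds (3.35) at good scales), with `q₀ = 4`: «Applying this argument on a nested
exhaustion … and taking a diagonal subsequence, we find a vector field V such that V_j → V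
strongly in L^{q₀}_loc(R³ ∖ {0}). (3.28)» … «Passing to a further subsequence, P_j → P … (3.45)» —
the tangent is assembled along the sub-subsequence, which is again a sequence of good scales.
[cite: Wu2026, §3.2–§3.4 p.9–19] -/
theorem step_construct_of_pieces
    (hA : ∀ ν : ℝ, 0 < ν → ∀ (v : E3 → E3) (p : E3 → ℝ), IsWuFlow ν v p →
      MemWeakLp v ((9 : ℝ≥0∞) / 2) volume →
      (∀ q : ℝ, 1 < q → q < 9 / 2 → ∃ C : ℝ, ∀ R : ℝ, 0 < R →
        IntegrableOn (fun x => ‖v x‖ ^ q) (annulus R) ∧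
        (∫ x in annulus R, ‖v x‖ ^ q) ^ (1 / q) ≤ C * R ^ (-(2 : ℝ) / 3 + 3 / q)) →
      ∀ n : ℕ → ℕ, Tendsto n atTop atTop →
      ∃ σ : ℕ → ℕ, StrictMono σ ∧ ∃ V : E3 → E3, AEStronglyMeasurable V volume ∧
        (∀ K : Set E3, IsCompact K → K ⊆ punctured →
          IntegrableOn (fun y => ‖V y‖ ^ (4 : ℝ)) K) ∧
        (∀ K : Set E3, IsCompact K → K ⊆ punctured →
          Tendsto (fun j => ∫ y in K, ‖blowDown ((2 : ℝ) ^ n (σ j)) v y - V y‖ ^ (4 : ℝ))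
            atTop (𝓝 0)))
    (hB : ∀ ν : ℝ, 0 < ν → ∀ (v : E3 → E3) (p : E3 → ℝ), IsWuFlow ν v p →
      MemWeakLp v ((9 : ℝ≥0∞) / 2) volume →
      (∀ q : ℝ, 1 < q → q < 9 / 2 → ∃ C : ℝ, ∀ R : ℝ, 0 < R →
        IntegrableOn (fun x => ‖v x‖ ^ q) (annulus R) ∧
        (∫ x in annulus R, ‖v x‖ ^ q) ^ (1 / q) ≤ C * R ^ (-(2 : ℝ) / 3 + 3 / q)) →
      ∀ c : ℝ, MemWeakLp (fun x => p x - c) ((9 : ℝ≥0∞) / 4) volume →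
        MemWeakLp (bern v (fun x => p x - c)) ((9 : ℝ≥0∞) / 4) volume →
      ∀ n : ℕ → ℕ, Tendsto n atTop atTop →
      ∀ V : E3 → E3, AEStronglyMeasurable V volume →
        (∀ K : Set E3, IsCompact K → K ⊆ punctured →
          IntegrableOn (fun y => ‖V y‖ ^ (4 : ℝ)) K) →
        (∀ K : Set E3, IsCompact K → K ⊆ punctured →
          Tendsto (fun j => ∫ y in K, ‖blowDown ((2 : ℝ) ^ n j) v y - V y‖ ^ (4 : ℝ))
            atTop (𝓝 0)) →
      ∃ σ : ℕ → ℕ, StrictMono σ ∧ ∃ P : E3 → ℝ, AEStronglyMeasurable P volume ∧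
        (∀ K : Set E3, IsCompact K → K ⊆ punctured →
          IntegrableOn (fun y => |P y| ^ ((4 : ℝ) / 2)) K) ∧
        (∀ K : Set E3, IsCompact K → K ⊆ punctured →
          Tendsto (fun j => ∫ y in K,
            |blowDownP ((2 : ℝ) ^ n (σ j)) (fun x => p x - c) y - P y| ^ ((4 : ℝ) / 2))
            atTop (𝓝 0)))
    (hC : ∀ ν : ℝ, 0 < ν → ∀ (v : E3 → E3) (p : E3 → ℝ), IsWuFlow ν v p → dirichlet v < ∞ →
      ∀ c : ℝ, ∀ n : ℕ → ℕ, Tendsto n atTop atTop →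
      ∀ (V : E3 → E3) (P : E3 → ℝ), AEStronglyMeasurable V volume →
        AEStronglyMeasurable P volume →
        (∀ K : Set E3, IsCompact K → K ⊆ punctured →
          IntegrableOn (fun y => ‖V y‖ ^ (4 : ℝ)) K ∧
            IntegrableOn (fun y => |P y| ^ ((4 : ℝ) / 2)) K) →
        (∀ K : Set E3, IsCompact K → K ⊆ punctured →
          Tendsto (fun j => ∫ y in K, ‖blowDown ((2 : ℝ) ^ n j) v y - V y‖ ^ (4 : ℝ))
            atTop (𝓝 0)) →
        (∀ K : Set E3, IsCompact K → K ⊆ punctured →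
          Tendsto (fun j => ∫ y in K,
            |blowDownP ((2 : ℝ) ^ n j) (fun x => p x - c) y - P y| ^ ((4 : ℝ) / 2))
            atTop (𝓝 0)) →
      (∀ Φ : E3 → E3, IsTestVec punctured Φ →
          ∫ y, (⟪V y, fderiv ℝ Φ y (V y)⟫ + P y * VectorCalculus.divergence Φ y) = 0) ∧
        WeakDivFreeOn punctured V ∧
        WeakDivFreeOn punctured (fun y => bern V P y • V y))
    (hD : ∀ ν : ℝ, 0 < ν → ∀ (v : E3 → E3) (p : E3 → ℝ), IsWuFlow ν v p →
      MemWeakLp v ((9 : ℝ≥0∞) / 2) volume →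
      ∀ c : ℝ, MemWeakLp (fun x => p x - c) ((9 : ℝ≥0∞) / 4) volume →
        MemWeakLp (bern v (fun x => p x - c)) ((9 : ℝ≥0∞) / 4) volume →
      ∀ n : ℕ → ℕ, Tendsto n atTop atTop →
      ∀ (V : E3 → E3) (P : E3 → ℝ), AEStronglyMeasurable V volume →
        AEStronglyMeasurable P volume →
        (∀ K : Set E3, IsCompact K → K ⊆ punctured →
          IntegrableOn (fun y => ‖V y‖ ^ (4 : ℝ)) K ∧
            IntegrableOn (fun y => |P y| ^ ((4 : ℝ) / 2)) K) →
        (∀ K : Set E3, IsCompact K → K ⊆ punctured →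
          Tendsto (fun j => ∫ y in K, ‖blowDown ((2 : ℝ) ^ n j) v y - V y‖ ^ (4 : ℝ))
            atTop (𝓝 0)) →
        (∀ K : Set E3, IsCompact K → K ⊆ punctured →
          Tendsto (fun j => ∫ y in K,
            |blowDownP ((2 : ℝ) ^ n j) (fun x => p x - c) y - P y| ^ ((4 : ℝ) / 2))
            atTop (𝓝 0)) →
      ∃ C : ℝ, 0 ≤ C ∧ ∀ R : ℝ, 0 < R → ∀ t : ℝ, 0 < t →
        (volume {y | y ∈ annulus R ∧ t < ‖V y‖}).toReal ≤ C * t ^ (-((9 : ℝ) / 2)) ∧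
        (volume {y | y ∈ annulus R ∧ t < |bern V P y|}).toReal ≤ C * t ^ (-((9 : ℝ) / 4)) ∧
        (volume {y | y ∈ annulus R ∧ t < |bern V P y| * ‖V y‖}).toReal ≤
          C * t ^ (-((3 : ℝ) / 2)))
    (hE : ∀ ν : ℝ, 0 < ν → ∀ (v : E3 → E3) (p : E3 → ℝ), IsWuFlow ν v p →
      MemWeakLp v ((9 : ℝ≥0∞) / 2) volume →
      (∀ q : ℝ, 1 < q → q < 9 / 2 → ∃ C : ℝ, ∀ R : ℝ, 0 < R →
        IntegrableOn (fun x => ‖v x‖ ^ q) (annulus R) ∧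
        (∫ x in annulus R, ‖v x‖ ^ q) ^ (1 / q) ≤ C * R ^ (-(2 : ℝ) / 3 + 3 / q)) →
      ∀ n : ℕ → ℕ, Tendsto n atTop atTop →
        (∀ m : ℕ, ∃ B : ℝ, ∀ j : ℕ, max 1 m ≤ j → dyMass v (n j + m) ≤ B) →
      ∀ V : E3 → E3, AEStronglyMeasurable V volume →
        (∀ K : Set E3, IsCompact K → K ⊆ punctured →
          IntegrableOn (fun y => ‖V y‖ ^ (4 : ℝ)) K) →
        (∀ K : Set E3, IsCompact K → K ⊆ punctured →
          Tendsto (fun j => ∫ y in K, ‖blowDown ((2 : ℝ) ^ n j) v y - V y‖ ^ (4 : ℝ))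
            atTop (𝓝 0)) →
      ∃ G : E3 → Fin 3 → E3,
        (∀ K : Set E3, IsCompact K → K ⊆ exterior →
          IntegrableOn (fun y => (∑ k, ‖G y k‖ ^ 2) ^ ((9 : ℝ) / 10)) K ∧
          IntegrableOn (fun y => ‖V y‖ ^ ((9 : ℝ) / 2)) K) ∧
        ∀ φ : E3 → ℝ, IsTest exterior φ → ∀ k : Fin 3,
          ∫ y, (fderiv ℝ φ y (EuclideanSpace.single k 1)) • V y = -∫ y, φ y • G y k) :
    Step_construct := by
  intro ν hν v p hflow hDfin _hDpos hweak h318 c hpc hbern n₀ hn₀ hgood₀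
  -- (A) velocity compactness along a subsequence `σ₁`
  obtain ⟨σ₁, hσ₁, V, hVm, hVint, hVconv₁⟩ := hA ν hν v p hflow hweak h318 n₀ hn₀
  set n₁ : ℕ → ℕ := fun j => n₀ (σ₁ j) with hn₁_def
  have hn₁ : Tendsto n₁ atTop atTop := hn₀.comp hσ₁.tendsto_atTop
  have hVconv₁' : ∀ K : Set E3, IsCompact K → K ⊆ punctured →
      Tendsto (fun j => ∫ y in K, ‖blowDown ((2 : ℝ) ^ n₁ j) v y - V y‖ ^ (4 : ℝ))
        atTop (𝓝 0) := fun K hK hKp => hVconv₁ K hK hKp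
  -- (B) pressure compactness along a further subsequence `σ₂`
  obtain ⟨σ₂, hσ₂, P, hPm, hPint, hPconv⟩ :=
    hB ν hν v p hflow hweak h318 c hpc hbern n₁ hn₁ V hVm hVint hVconv₁'
  set n₂ : ℕ → ℕ := fun j => n₁ (σ₂ j) with hn₂_def
  have hn₂ : Tendsto n₂ atTop atTop := hn₁.comp hσ₂.tendsto_atTop
  have hgood₂ : ∀ m : ℕ, ∃ B : ℝ, ∀ j : ℕ, max 1 m ≤ j → dyMass v (n₂ j + m) ≤ B :=
    good_comp_strictMono (good_comp_strictMono hgood₀ hσ₁) hσ₂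
  have hVconv : ∀ K : Set E3, IsCompact K → K ⊆ punctured →
      Tendsto (fun j => ∫ y in K, ‖blowDown ((2 : ℝ) ^ n₂ j) v y - V y‖ ^ (4 : ℝ))
        atTop (𝓝 0) := fun K hK hKp => (hVconv₁' K hK hKp).comp hσ₂.tendsto_atTop
  have hPconv' : ∀ K : Set E3, IsCompact K → K ⊆ punctured →
      Tendsto (fun j => ∫ y in K,
        |blowDownP ((2 : ℝ) ^ n₂ j) (fun x => p x - c) y - P y| ^ ((4 : ℝ) / 2)) atTop (𝓝 0) :=
    fun K hK hKp => hPconv K hK hKp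
  have hlocInt : ∀ K : Set E3, IsCompact K → K ⊆ punctured →
      IntegrableOn (fun y => ‖V y‖ ^ (4 : ℝ)) K ∧ IntegrableOn (fun y => |P y| ^ ((4 : ℝ) / 2)) K :=
    fun K hK hKp => ⟨hVint K hK hKp, hPint K hK hKp⟩
  -- (C), (D), (E) along `n₂`
  obtain ⟨heuler, hdivFree, hbernLaw⟩ :=
    hC ν hν v p hflow hDfin c n₂ hn₂ V P hVm hPm hlocInt hVconv hPconv'
  obtain ⟨C, hC0, hCbd⟩ := hD ν hν v p hflow hweak c hpc hbern n₂ hn₂ V P hVm hPm hlocInt hVconv hPconv'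
  obtain ⟨G, hGint, hGweak⟩ := hE ν hν v p hflow hweak h318 n₂ hn₂ hgood₂ V hVm hVint hVconv
  refine ⟨{ q0 := 4
            hq0 := by norm_num
            n := n₂
            n_tendsto := hn₂
            good := hgood₂
            c := c
            weakP := ⟨hpc, hbern⟩
            V := V
            P := P
            locInt := ⟨hVm, hPm, hlocInt⟩
            convV := hVconv
            convP := hPconv'
            weakBd := ⟨C, hC0, hCbd⟩
            sobolev := ⟨G, hGint, hGweak⟩
            euler := heuler
            divFree := hdivFree
            bernLaw := hbernLaw }, rfl⟩

end Summit.NavierStokesRegularity.NavierStokesRegularity.Theorems.Wu2026Salvage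

end

-- WHAT THIS IS NOT: not a claim about NS regularity or blow-up; not a claim about any author beyond the typed locator.
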